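import Summits.RiemannHypothesis.RiemannHypothesis.Theorems.TiltedLandingLaw421R3RateUncoveredSign

/-!
# ConeRatio (C4 «kernel desk» rh-idea-6 g42, W-09 F-LINK) — (P3) of C3's closure map, PROVED: the CONE IDENTITY and the CONE-RATIO BOUND per far pair (a CONTENT piece of real algebra, not a door; C4 asks no token — the director judges)

C3 g53 LOWGAIN §4 (P3): «per far pair, M₂-weight = (d²+c²+y²)/(y·(d²+y²−c²)) × down-pull outside the cone».  For a point `p = x + iy` and a far zero
`u = a + ic` with its reflected partner `ū` write `d := x − a`.  The pair's M₂-WEIGHT (the size of `d/dp` of its polar part) is `1/|p−u|² + 1/|p−ū|²`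
and its DOWN-PULL is `−pairPull p u` with the TREE's `RhW08.UncoveredSign.pairPull p u = Im(1/(p−u) + 1/(p−ū))` (`…Theorems.TiltedLandingLaw421R3RateUncoveredSign`,
cited by name; its sign theorem `pairPull_neg_iff` = «pulls down iff uncovered» is NOT restated).  Proved here (all K, pure algebra over `ℂ`):
* `pairWeight_eq`: `1/|p−u|² + 1/|p−ū|² = 2(d²+y²+c²)/(|p−u|²|p−ū|²)`;
* `neg_pairPull_eq`: `−pairPull p u = 2y(d²+y²−c²)/(|p−u|²|p−ū|²)` — so OUTSIDE the cone (`c² < d²+y²`, `0 < y`) the ratio weight/down-pull is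
  `(d²+y²+c²)/(y(d²+y²−c²))`, increasing in `c²`;
* ★ `pairWeight_le_coneRatio_mul_negPull`: if `c² ≤ H < d²+y²` and `0 < y` then `weight ≤ (d²+y²+H)/(y(d²+y²−H)) · (−pairPull p u)` — (P4)'s `ρ_max`
  with `H = Hs²` (strip zeros) and `d ≥ d_min`;
* `pairWeight_le_three_div_mul_negPull`: the «bulk» case `2c² ≤ d²+y²` gives `weight ≤ (3/y)·(−pairPull p u)`.
What it is for: with 127 «SegmentMVT» ((P1): gain ≤ |δ|·sup_{[p₀,w]} ‖lineRem′‖) and (P2) (‖lineRem′(p)‖ ≤ Σ_far m·weight — the Hadamard step, NOT here),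
the derivative budget on the cone-free region becomes `ρ_max · (total down-pull)`, which (P2c)/(P2d) bound by the drop.  Nothing here bears on the truth
of RH; ⟨33346⟩/⟨33347⟩ OPEN.
-/

namespace RhW08.GainCone

open Complex
open RhIdea5.G17.W07C9.Helpers (normSq_sub_eq normSq_sub_conj_eq)
open RhW08.UncoveredSign (pairPull)

/-- outside-the-cone data forces `p ∉ {u, ū}`: both squared distances are positive. -/
theorem normSq_pos_of_cone {p u : ℂ} {H : ℝ} (hc : u.im ^ 2 ≤ H) (hH : H < (p.re - u.re) ^ 2 + p.im ^ 2) :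
    0 < Complex.normSq (p - u) ∧ 0 < Complex.normSq (p - (starRingEnd ℂ) u) := by
  rw [normSq_sub_eq, normSq_sub_conj_eq]
  constructor
  · by_contra h
    have h : (p.re - u.re) ^ 2 + (p.im - u.im) ^ 2 ≤ 0 := not_lt.mp h
    have h1 : (p.re - u.re) ^ 2 = 0 := by nlinarith [sq_nonneg (p.re - u.re), sq_nonneg (p.im - u.im)]
    have h2 : (p.im - u.im) ^ 2 = 0 := by nlinarith [sq_nonneg (p.re - u.re), sq_nonneg (p.im - u.im)]
    have h3 : p.im = u.im := by nlinarith [sq_nonneg (p.im - u.im)]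
    rw [h3] at hH
    linarith
  · by_contra h
    have h : (p.re - u.re) ^ 2 + (p.im + u.im) ^ 2 ≤ 0 := not_lt.mp h
    have h1 : (p.re - u.re) ^ 2 = 0 := by nlinarith [sq_nonneg (p.re - u.re), sq_nonneg (p.im + u.im)]
    have h2 : (p.im + u.im) ^ 2 = 0 := by nlinarith [sq_nonneg (p.re - u.re), sq_nonneg (p.im + u.im)]
    have h3 : p.im = -u.im := by nlinarith [sq_nonneg (p.im + u.im)]
    rw [h3] at hH
    have : (-u.im) ^ 2 = u.im ^ 2 := by ring
    linarith

/-- (K) the pair's M₂-WEIGHT in closed form: `1/|p−u|² + 1/|p−ū|² = 2(d²+y²+c²)/(|p−u|²·|p−ū|²)`. -/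
theorem pairWeight_eq {p u : ℂ} (h1 : 0 < Complex.normSq (p - u)) (h2 : 0 < Complex.normSq (p - (starRingEnd ℂ) u)) :
    (Complex.normSq (p - u))⁻¹ + (Complex.normSq (p - (starRingEnd ℂ) u))⁻¹
      = 2 * ((p.re - u.re) ^ 2 + p.im ^ 2 + u.im ^ 2) / (Complex.normSq (p - u) * Complex.normSq (p - (starRingEnd ℂ) u)) := by
  rw [inv_add_inv (ne_of_gt h1) (ne_of_gt h2)]
  congr 1
  rw [normSq_sub_eq, normSq_sub_conj_eq]
  ring

/-- (K) the pair's DOWN-PULL in closed form: `−pairPull p u = 2y(d²+y²−c²)/(|p−u|²·|p−ū|²)` (positive exactly outside the cone, cf. the tree's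
`RhW08.UncoveredSign.pairPull_neg_iff`). -/
theorem neg_pairPull_eq {p u : ℂ} (h1 : 0 < Complex.normSq (p - u)) (h2 : 0 < Complex.normSq (p - (starRingEnd ℂ) u)) :
    -pairPull p u
      = 2 * p.im * ((p.re - u.re) ^ 2 + p.im ^ 2 - u.im ^ 2) / (Complex.normSq (p - u) * Complex.normSq (p - (starRingEnd ℂ) u)) := by
  rw [pairPull, neg_sub, div_sub_div _ _ (ne_of_gt h2) (ne_of_gt h1),
    mul_comm (Complex.normSq (p - (starRingEnd ℂ) u)) (Complex.normSq (p - u))]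
  congr 1
  rw [normSq_sub_eq, normSq_sub_conj_eq]
  ring

/-- ★ (K) **(P3) CONE-RATIO BOUND**: if the far zero's height satisfies `c² ≤ H` and the point is outside the `H`-cone (`H < d²+y²`, `0 < y`), then
`weight ≤ ρ · (−pairPull p u)` with `ρ = (d²+y²+H)/(y·(d²+y²−H))` — the ratio is increasing in `c²`, so the worst case is `c² = H`. -/
theorem pairWeight_le_coneRatio_mul_negPull {p u : ℂ} {H : ℝ} (hy : 0 < p.im) (hc : u.im ^ 2 ≤ H)
    (hH : H < (p.re - u.re) ^ 2 + p.im ^ 2) :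
    (Complex.normSq (p - u))⁻¹ + (Complex.normSq (p - (starRingEnd ℂ) u))⁻¹
      ≤ ((p.re - u.re) ^ 2 + p.im ^ 2 + H) / (p.im * ((p.re - u.re) ^ 2 + p.im ^ 2 - H)) * (-pairPull p u) := by
  obtain ⟨h1, h2⟩ := normSq_pos_of_cone hc hH
  rw [pairWeight_eq h1 h2, neg_pairPull_eq h1 h2]
  set S : ℝ := (p.re - u.re) ^ 2 + p.im ^ 2 with hS
  set N : ℝ := Complex.normSq (p - u) * Complex.normSq (p - (starRingEnd ℂ) u) with hN
  have hNpos : 0 < N := mul_pos h1 h2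
  have hSH : 0 < S - H := by linarith
  have hc0 : 0 ≤ u.im ^ 2 := sq_nonneg _
  have hS0 : 0 < S := by linarith
  -- the comparison of numerators: (S + c²)(S − H) ≤ (S + H)(S − c²)  ⟺  2·S·c² ≤ 2·S·H
  have key : 2 * (S + u.im ^ 2) ≤ (S + H) / (p.im * (S - H)) * (2 * p.im * (S - u.im ^ 2)) := by
    rw [div_mul_eq_mul_div, le_div_iff₀ (mul_pos hy hSH)]
    nlinarith [mul_nonneg hS0.le (sub_nonneg.mpr hc), hy]
  calc 2 * (S + u.im ^ 2) / N ≤ (S + H) / (p.im * (S - H)) * (2 * p.im * (S - u.im ^ 2)) / N :=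
        div_le_div_of_nonneg_right key hNpos.le
    _ = (S + H) / (p.im * (S - H)) * (2 * p.im * (S - u.im ^ 2) / N) := by rw [mul_div_assoc]

/-- (K) the «BULK» case of (P3): `2c² ≤ d²+y²` and `0 < y` give `weight ≤ (3/y)·(−pairPull p u)`. -/
theorem pairWeight_le_three_div_mul_negPull {p u : ℂ} (hy : 0 < p.im) (hc : 2 * u.im ^ 2 ≤ (p.re - u.re) ^ 2 + p.im ^ 2) :
    (Complex.normSq (p - u))⁻¹ + (Complex.normSq (p - (starRingEnd ℂ) u))⁻¹ ≤ 3 / p.im * (-pairPull p u) := by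
  set S : ℝ := (p.re - u.re) ^ 2 + p.im ^ 2 with hS
  have hS0 : 0 < S := by have := sq_nonneg (p.re - u.re); nlinarith
  have hc' : u.im ^ 2 ≤ S / 2 := by linarith
  have hH : S / 2 < (p.re - u.re) ^ 2 + p.im ^ 2 := by rw [← hS]; linarith
  have h := pairWeight_le_coneRatio_mul_negPull hy hc' hH
  have hρ : ((p.re - u.re) ^ 2 + p.im ^ 2 + S / 2) / (p.im * ((p.re - u.re) ^ 2 + p.im ^ 2 - S / 2)) = 3 / p.im := by
    rw [← hS]
    field_simp
    ring
  rwa [hρ] at h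

end RhW08.GainCone
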